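import Summits.CriticalPhenomena.PercolationContinuityZ3.Theorems.PercNearOneGluingNoHeavyLowerTailKNQuestion9PairSetSource
import HarnessLib

/-!
# Kozma–Nitzan's Question 9 for two relays, II — every finite graph and every weight vector

Support file (`--supports stmt-CriticalPhenomena-4575`), prover `prim-ineq-gen-7` (gen 8; memo
`prim-ineq-gen-7/PROOF-Q9-MIXED-CSH.md` §1).  No definitions, no named facts, no sorries.

Kozma–Nitzan, arXiv:2401.12397, QUESTION 9 (§5.5 p. 36): with `H = G − (edges at 0)` and `a ∈ A` the minimiser of
`P_H(a ↔ b)`, does the pre-FKG inequality (41) `P(0↔b, 0↔A) ≥ P(0↔A, a↔b)` hold?  THIS FILE: YES for `|A| ≤ 2`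
(`KnQ9Pair.kn_question9_card_le_two`, in the exact shape of the hypothesis `hQ9` of the tree's
`setSourceExchange_of_question9` / `knQuestion7_of_question9`, restricted to `A.card ≤ 2`).  Proof: law of total
probability over the pattern of the open star of `o` (`prodBernoulli_real_inter_eq_sum_pinW`); for a pinned star the
observer is a sure hub over `Σ = {s | s(o,s) open}`, the star dictionary `KnQ9Pair.reachable_iff_of_star` rewrites both
events of (41) on the relay configuration `ω ∩ wireSet {o}ᶜ`, whose law is `prodBernoulli (restrW {o}ᶜ w)`, and the
set-source inequality `KnQ9Pair.setSource_pair` (part I) concludes.  The tree's `Q7Psi.kn_question7` covers the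
designation by the `G`-minimiser only; `|A| = 2` with the `H`-minimiser is not in print.
[cite: KozmaNitzan2024, Question 9 (§5.5 p. 36), display (41), Thm. 1 (pp. 7–8)] [cite: VandenbergHaggstromKahn2005, Thm. 1.5 (p. 7)]
-/

noncomputable section

namespace Summit.CriticalPhenomena.PercolationContinuityZ3.Theorems

open MeasureTheory Set Literature.Probability.LatticeModels Literature.Probability.Percolation
open scoped Classical

namespace KnQ9Pair

variable {V : Type*} [Fintype V]

/-- **From the set-source form to the observer's graph, pinned star.**  If the pairs at the observer `o` have weights in
`{0, 1}` (law `pinW w F T`, `F` = the pairs at `o`), the observer is a sure hub over `Σ = {s | s(o,s) ∈ T}`; if the set-source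
inequality holds in the relay graph `restrW {o}ᶜ w` for this `Σ`, then (41) holds at `o` for the designated relay `c`:
`μ(c↔b ∩ o↔A) ≤ μ(o↔b ∩ o↔A)`.  (Star dictionary `reachable_iff_of_star` on the cylinder; events read on `ω ∩ wireSet {o}ᶜ` have the
same probability under the pinned law and under `restrW {o}ᶜ w`.) [cite: KozmaNitzan2024, Question 9 (§5.5 p. 36)] -/
theorem question9_pinned_of_setSource (w : Sym2 V → unitInterval) (o b c : V) (A : Finset V) (hbo : b ≠ o) (hco : c ≠ o)
    (hoA : o ∉ A) (F : Finset (Sym2 V)) (hF : ∀ e, e ∈ F ↔ o ∈ e ∧ ¬ e.IsDiag) (T : Finset (Sym2 V))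
    (hSSF : (prodBernoulli (restrW ({o}ᶜ : Set V) w)).real
        {η : BondConfig V | ((openGraph η).Reachable c b ∨
            ((∃ s ∈ {s : V | s ≠ o ∧ s(o, s) ∈ T}, (openGraph η).Reachable s c) ∧
              ∃ s ∈ {s : V | s ≠ o ∧ s(o, s) ∈ T}, (openGraph η).Reachable s b)) ∧
          ∃ a ∈ A, ∃ s ∈ {s : V | s ≠ o ∧ s(o, s) ∈ T}, (openGraph η).Reachable s a} ≤
      (prodBernoulli (restrW ({o}ᶜ : Set V) w)).real
        {η : BondConfig V | (∃ s ∈ {s : V | s ≠ o ∧ s(o, s) ∈ T}, (openGraph η).Reachable s b) ∧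
          ∃ a ∈ A, ∃ s ∈ {s : V | s ≠ o ∧ s(o, s) ∈ T}, (openGraph η).Reachable s a}) :
    (prodBernoulli (pinW w ↑F ↑T)).real (openConn c b ∩ ⋃ a ∈ A, openConn o a) ≤
      (prodBernoulli (pinW w ↑F ↑T)).real (openConn o b ∩ ⋃ a ∈ A, openConn o a) := by
  classical
  set wT := pinW w (↑F : Set (Sym2 V)) ↑T with hwT
  set wH := restrW ({o}ᶜ : Set V) w with hwH
  set Sig : Set V := {s | s ≠ o ∧ s(o, s) ∈ T} with hSig
  have hoS : o ∉ Sig := fun h => h.1 rfl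
  have hmeas : ∀ A : Set (BondConfig V), MeasurableSet A := fun _ => MeasurableSet.of_discrete
  -- the dictionary holds on the cylinder
  have hcyl : ∀ ω ∈ localCylinder (↑F : Set (Sym2 V)) ↑T, ∀ s : V, s ≠ o → (s(o, s) ∈ ω ↔ s ∈ Sig) := by
    intro ω hω s hso
    have hsF : s(o, s) ∈ (↑F : Set (Sym2 V)) := by
      rw [Finset.mem_coe, hF]
      exact ⟨Sym2.mem_mk_left o s, by rw [Sym2.mk_isDiag_iff]; exact Ne.symm hso⟩
    rw [hω _ hsF, Finset.mem_coe, hSig]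
    simp [hso]
  -- hub-form events, read on `ω ∩ wireSet {o}ᶜ`
  set wire : Set (Sym2 V) := wireSet ({o}ᶜ : Set V) with hwire
  set PL : BondConfig V → Prop := fun η => ((openGraph η).Reachable c b ∨
      ((∃ s ∈ Sig, (openGraph η).Reachable s c) ∧ ∃ s ∈ Sig, (openGraph η).Reachable s b)) ∧
      ∃ a ∈ A, ∃ s ∈ Sig, (openGraph η).Reachable s a with hPL
  set PR : BondConfig V → Prop := fun η => (∃ s ∈ Sig, (openGraph η).Reachable s b) ∧
      ∃ a ∈ A, ∃ s ∈ Sig, (openGraph η).Reachable s a with hPR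
  have hJ : ∀ (ω : BondConfig V) (z : V), z ≠ o →
      ((z = o ∨ ∃ s ∈ Sig, (openGraph (ω ∩ wire)).Reachable s z) ↔ ∃ s ∈ Sig, (openGraph (ω ∩ wire)).Reachable s z) :=
    fun ω z hz => ⟨fun h => h.resolve_left hz, fun h => Or.inr h⟩
  -- `o ↔ z` for `z ≠ o` means `Σ ↔ z` in the relay configuration
  have hoz : ∀ ω ∈ localCylinder (↑F : Set (Sym2 V)) ↑T, ∀ z : V, z ≠ o →
      ((openGraph ω).Reachable o z ↔ ∃ s ∈ Sig, (openGraph (ω ∩ wire)).Reachable s z) := by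
    intro ω hω z hz
    rw [reachable_iff_of_star ω o Sig hoS (hcyl ω hω) o z, reachable_inter_wireSet_self_iff, hJ ω z hz]
    exact ⟨fun h => h.elim (fun h => absurd h hz) fun h => h.2, fun h => Or.inr ⟨Or.inl rfl, h⟩⟩
  have hdictL : openConn c b ∩ (⋃ a ∈ A, openConn o a) ∩ localCylinder (↑F : Set (Sym2 V)) ↑T ⊆
      {ω | PL (ω ∩ wire)} := by
    rintro ω ⟨⟨hcb, hA⟩, hω⟩
    have hcb' := (reachable_iff_of_star ω o Sig hoS (hcyl ω hω) c b).1 hcb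
    rw [hJ ω c hco, hJ ω b hbo] at hcb'
    refine ⟨hcb', ?_⟩
    obtain ⟨a, ha, hoa⟩ := mem_iUnion₂.1 hA
    have hao : a ≠ o := fun h => hoA (h ▸ ha)
    exact ⟨a, ha, (hoz ω hω a hao).1 hoa⟩
  have hdictR : {ω | PR (ω ∩ wire)} ∩ localCylinder (↑F : Set (Sym2 V)) ↑T ⊆
      openConn o b ∩ ⋃ a ∈ A, openConn o a := by
    rintro ω ⟨⟨hb, a, ha, hsa⟩, hω⟩
    have hao : a ≠ o := fun h => hoA (h ▸ ha)
    exact ⟨(hoz ω hω b hbo).2 hb, mem_iUnion₂.2 ⟨a, ha, (hoz ω hω a hao).2 hsa⟩⟩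
  -- measures under the pinned law may be computed inside the cylinder
  have hFc : (↑F : Set (Sym2 V)).Countable := F.finite_toSet.countable
  have h1 : (prodBernoulli wT).real (openConn c b ∩ ⋃ a ∈ A, openConn o a) ≤
      (prodBernoulli wT).real {ω | PL (ω ∩ wire)} := prodBernoulli_pinW_real_mono_of_inter w hFc ↑T hdictL
  have h2 : (prodBernoulli wT).real {ω | PR (ω ∩ wire)} ≤
      (prodBernoulli wT).real (openConn o b ∩ ⋃ a ∈ A, openConn o a) :=
    prodBernoulli_pinW_real_mono_of_inter w hFc ↑T hdictR
  -- events read on `ω ∩ wire` are determined by `wire`, where `wT` and `wH` agree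
  have hdet : ∀ P : BondConfig V → Prop, DeterminedBy {ω : BondConfig V | P (ω ∩ wire)} wire := by
    intro P
    rw [determinedBy_iff]
    intro ω ω' h
    simp only [mem_setOf_eq, h]
  have hagree : ∀ e ∈ wire, wT e = wH e := by
    intro e he
    have heF : e ∉ (↑F : Set (Sym2 V)) := by
      rw [Finset.mem_coe, hF]
      intro h'
      exact (he.1 o h'.1) rfl
    rw [hwT, pinW_apply_of_not_mem w _ heF, hwH, restrW_apply_of_mem w he]
  have h3 : ∀ P : BondConfig V → Prop,
      (prodBernoulli wT).real {ω | P (ω ∩ wire)} = (prodBernoulli wH).real {ω | P (ω ∩ wire)} :=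
    fun P => prodBernoulli_real_eq_of_determinedBy wT wH hagree (hdet P) (hmeas _)
  -- under `wH` the pairs off `wire` are closed: `P(ω ∩ wire)` and `P(ω)` have the same probability
  have h4 : ∀ P : BondConfig V → Prop,
      (prodBernoulli wH).real {ω | P (ω ∩ wire)} = (prodBernoulli wH).real {ω | P ω} := by
    intro P
    rw [← integral_indicator_one (hmeas _), ← integral_indicator_one (hmeas _)]
    have e : ∀ η : BondConfig V, ({ω : BondConfig V | P (ω ∩ wire)}).indicator (1 : BondConfig V → ℝ) η =
        ({ω : BondConfig V | P ω}).indicator (1 : BondConfig V → ℝ) (η \ wireᶜ) := by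
      intro η
      rw [Set.sdiff_compl]
      by_cases h : P (η ∩ wire)
      · rw [indicator_of_mem (show η ∈ {ω : BondConfig V | P (ω ∩ wire)} from h),
          indicator_of_mem (show η ∩ wire ∈ {ω : BondConfig V | P ω} from h)]
        rfl
      · rw [indicator_of_notMem (show η ∉ {ω : BondConfig V | P (ω ∩ wire)} from h),
          indicator_of_notMem (show η ∩ wire ∉ {ω : BondConfig V | P ω} from h)]
    simp_rw [e]
    exact BHK2006.integral_comp_sdiff_prodBernoulli' wH wH wireᶜ
      (fun i hi => by rw [hwH, restrW_apply_of_not_mem w (show i ∉ wireSet ({o}ᶜ : Set V) from hi)])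
      (fun _ _ => rfl) _
  calc (prodBernoulli wT).real (openConn c b ∩ ⋃ a ∈ A, openConn o a)
      ≤ (prodBernoulli wT).real {ω | PL (ω ∩ wire)} := h1
    _ = (prodBernoulli wH).real {ω | PL ω} := by rw [h3, h4]
    _ ≤ (prodBernoulli wH).real {ω | PR ω} := hSSF
    _ = (prodBernoulli wT).real {ω | PR (ω ∩ wire)} := by rw [h3, h4]
    _ ≤ (prodBernoulli wT).real (openConn o b ∩ ⋃ a ∈ A, openConn o a) := h2

/-- **The star reduction (R1 of the memo): Question 9 at `o` follows from the set-source form in the relay graph for every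
source set `Σ ⊆ V ∖ {o}`.**  For `c ∈ A`, `o ∉ A`, `b ≠ o`: if for every `Σ` not containing `o`
`P_H(c ↔^Σ b, Σ ↔ A) ≤ P_H(Σ ↔ b, Σ ↔ A)` (`H = restrW {o}ᶜ w`), then `P_G(c↔b, o↔A) ≤ P_G(o↔b, o↔A)`.  (Law of total probability
over the pattern of the open star of `o`, `prodBernoulli_real_inter_eq_sum_pinW`, + `question9_pinned_of_setSource`.)  This is the socket
through which the mixed conditioned slack hierarchy (memo prim-ineq-gen-7/PROOF-Q9-MIXED-CSH.md, Theorem M2) delivers Question 9 for every `|A|`.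
[cite: KozmaNitzan2024, Question 9 (§5.5 p. 36)] -/
theorem question9_of_setSource (w : Sym2 V → unitInterval) (o b c : V) (A : Finset V) (hbo : b ≠ o) (hco : c ≠ o) (hoA : o ∉ A)
    (hSSF : ∀ Sig : Set V, o ∉ Sig →
      (prodBernoulli (restrW ({o}ᶜ : Set V) w)).real
        {η : BondConfig V | ((openGraph η).Reachable c b ∨
            ((∃ s ∈ Sig, (openGraph η).Reachable s c) ∧ ∃ s ∈ Sig, (openGraph η).Reachable s b)) ∧
          ∃ a ∈ A, ∃ s ∈ Sig, (openGraph η).Reachable s a} ≤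
      (prodBernoulli (restrW ({o}ᶜ : Set V) w)).real
        {η : BondConfig V | (∃ s ∈ Sig, (openGraph η).Reachable s b) ∧ ∃ a ∈ A, ∃ s ∈ Sig, (openGraph η).Reachable s a}) :
    (prodBernoulli w).real (openConn c b ∩ ⋃ a ∈ A, openConn o a) ≤
      (prodBernoulli w).real (openConn o b ∩ ⋃ a ∈ A, openConn o a) := by
  classical
  have hmeas : ∀ A : Set (BondConfig V), MeasurableSet A := fun _ => MeasurableSet.of_discrete
  set F : Finset (Sym2 V) := Finset.univ.filter (fun e : Sym2 V => o ∈ e ∧ ¬ e.IsDiag) with hFdef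
  have hF : ∀ e, e ∈ F ↔ o ∈ e ∧ ¬ e.IsDiag := fun e => by simp [hFdef]
  have key := fun (E : Set (BondConfig V)) =>
    prodBernoulli_real_inter_eq_sum_pinW w F (A := E) (hmeas E) (determinedBy_univ (↑F : Set (Sym2 V)))
  simp only [inter_univ] at key
  rw [key, key]
  refine Finset.sum_le_sum fun T _ => ?_
  exact mul_le_mul_of_nonneg_left (question9_pinned_of_setSource w o b c A hbo hco hoA F hF T
    (hSSF {s : V | s ≠ o ∧ s(o, s) ∈ T} (fun h => h.1 rfl))) measureReal_nonneg

/-- **KOZMA–NITZAN'S QUESTION 9 FOR TWO RELAYS — every finite graph, every weight vector.**  Let `H` be `G` with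
the pairs at the observer `o` closed (`restrW {o}ᶜ w`), `A = {c, k}` and `c` the `H`-minimiser: `P_H(c↔b) ≤ P_H(k↔b)`.
Then `P_G(c↔b, o↔A) ≤ P_G(o↔b, o↔A)` — the pre-FKG inequality (41) for the Question-9 designation (`question9_of_setSource` +
`setSource_pair`). [cite: KozmaNitzan2024, Question 9 (§5.5 p. 36), display (41)] -/
theorem kn_question9_pair (w : Sym2 V → unitInterval) (o b c k : V) (hco : c ≠ o) (hko : k ≠ o) (hkc : k ≠ c)
    (hmin : (prodBernoulli (restrW ({o}ᶜ : Set V) w)).real (openConn c b) ≤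
      (prodBernoulli (restrW ({o}ᶜ : Set V) w)).real (openConn k b)) :
    (prodBernoulli w).real (openConn c b ∩ ⋃ a ∈ ({c, k} : Finset V), openConn o a) ≤
      (prodBernoulli w).real (openConn o b ∩ ⋃ a ∈ ({c, k} : Finset V), openConn o a) := by
  classical
  by_cases hbo : b = o
  · subst hbo
    refine measureReal_mono ?_ (measure_ne_top _ _)
    rintro ω ⟨_, h⟩
    exact ⟨SimpleGraph.Reachable.refl _, h⟩
  have hoA : o ∉ ({c, k} : Finset V) := by
    simp only [Finset.mem_insert, Finset.mem_singleton, not_or]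
    exact ⟨hco.symm, hko.symm⟩
  refine question9_of_setSource w o b c {c, k} hbo hco hoA fun Sig _ => ?_
  have hA : ∀ (η : BondConfig V), (∃ a ∈ ({c, k} : Finset V), ∃ s ∈ Sig, (openGraph η).Reachable s a) ↔
      ((∃ s ∈ Sig, (openGraph η).Reachable s c) ∨ ∃ s ∈ Sig, (openGraph η).Reachable s k) := by
    intro η
    simp only [Finset.mem_insert, Finset.mem_singleton, exists_eq_or_imp, exists_eq_left]
  simp only [hA]
  exact setSource_pair (restrW ({o}ᶜ : Set V) w) Sig b c k hkc hmin

/-- **Question 9 for `|A| = 2` in the shape of the tree's Question-9 hypothesis** (`KnQ9Hub`, `setSourceExchange_of_question9`: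
`∀ W w A o b a, o ∉ A → a ∈ A → (∀ a' ∈ A, P_{restrW {o}ᶜ w}(a↔b) ≤ P_{restrW {o}ᶜ w}(a'↔b)) → μ(a↔b ∩ connTo o A) ≤ μ(o↔b ∩ connTo o A)`),
for relay sets with at most two elements. [cite: KozmaNitzan2024, Question 9 (§5.5 p. 36)] -/
theorem kn_question9_card_le_two (w : Sym2 V → unitInterval) (A : Finset V) (hA : A.card ≤ 2) (o b a : V)
    (hoA : o ∉ A) (haA : a ∈ A)
    (hmin : ∀ a' ∈ A, (prodBernoulli (restrW ({o}ᶜ : Set V) w)).real (openConn a b) ≤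
      (prodBernoulli (restrW ({o}ᶜ : Set V) w)).real (openConn a' b)) :
    (prodBernoulli w).real (openConn a b ∩ ⋃ a' ∈ A, openConn o a') ≤
      (prodBernoulli w).real (openConn o b ∩ ⋃ a' ∈ A, openConn o a') := by
  classical
  have hao : a ≠ o := fun h => hoA (h ▸ haA)
  -- the second relay (possibly equal to `a`)
  obtain ⟨k, hkA, hAk⟩ : ∃ k ∈ A, ∀ x ∈ A, x = a ∨ x = k := by
    by_cases h1 : A.card ≤ 1
    · exact ⟨a, haA, fun x hx => Or.inl (Finset.card_le_one.1 h1 x hx a haA)⟩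
    · obtain ⟨k, hk, hka⟩ := Finset.exists_mem_ne (lt_of_not_ge h1) a
      refine ⟨k, hk, fun x hx => ?_⟩
      by_contra hx'
      have hxa : x ≠ a := fun h => hx' (Or.inl h)
      have hxk : x ≠ k := fun h => hx' (Or.inr h)
      have h3 : 2 < A.card := Finset.two_lt_card_iff.2 ⟨a, k, x, haA, hk, hx, hka.symm, hxa.symm, hxk.symm⟩
      omega
  have hU : (⋃ a' ∈ A, (openConn o a' : Set (BondConfig V))) = ⋃ a' ∈ ({a, k} : Finset V), openConn o a' := by
    ext ω
    simp only [mem_iUnion, exists_prop, Finset.mem_insert, Finset.mem_singleton]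
    constructor
    · rintro ⟨x, hx, h⟩
      exact ⟨x, hAk x hx, h⟩
    · rintro ⟨x, hx, h⟩
      rcases hx with rfl | rfl
      · exact ⟨x, haA, h⟩
      · exact ⟨x, hkA, h⟩
  rw [hU]
  by_cases hka : k = a
  · -- a single relay: on `{o ↔ a}` both events say `o ↔ b`
    subst hka
    refine measureReal_mono ?_ (measure_ne_top _ _)
    rintro ω ⟨hab, hoa⟩
    refine ⟨?_, hoa⟩
    obtain ⟨x, hx, hox⟩ := mem_iUnion₂.1 hoa
    have hxk : x = k := by simpa using hx
    subst hxk
    exact (show (openGraph ω).Reachable o x from hox).trans hab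
  have hko : k ≠ o := fun h => hoA (h ▸ hkA)
  exact kn_question9_pair w o b a k hao hko hka (hmin k hkA)

end KnQ9Pair

end Summit.CriticalPhenomena.PercolationContinuityZ3.Theorems
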